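import Literature.Probability.Percolation.ArmExponentsTwoArmProofs
import Mathlib.Analysis.Subadditive
import HarnessLib

/-!
# The exponent of the two-arm scaling limit exists by sub-multiplicativity (Fekete)

Topic `Literature/Probability/Percolation`; family `crit-perc`. Third proof-only companion of
`ArmExponentsTwoArm.lean` (named fact `SmirnovWerner2001_twoArm_scalingLimit`: S. Smirnov,
W. Werner, *Critical exponents for two-dimensional percolation*, Math. Res. Lett. **8** (2001)
729–744, §4, (16) with (9), `j = 2`; equation numbers of the arXiv text `math/0109120`), after
`ArmExponentsTwoArmProofs.lean` (the fact `⇔` (16)ℕ ∧ (9)ℕ: the two-arm probabilities of the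
integer annuli converge, `b₂(ρ r, ρ R) → L(r, R)`, and `log L(1, n) / log n → -1/4`) and
`TwoArmScalingLimitFromLoops.lean` / `TwoArmNoTouchingReduction.lean` ((16)ℕ from the
Camia–Newman loop limit). Theorems only: no definitions, no named facts.

Here the second conjunct (9)ℕ is split into an EXISTENCE statement, which is proved from (16)ℕ
alone, and a VALUE statement, for which several weaker sufficient forms are derived:

* **Existence of the exponent** (`TwoArmScalingLimit.exists_tendsto_log_limit_div_log`). If the
  limits `L(r, R)` of (16)ℕ exist, then `log L(1, n) / log n` converges to some `α ∈ ℝ`. This is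
  the remark behind Smirnov–Werner's use of the scaling limit in §4.2 (p. 9: (16) makes the
  limit depend "on the ratio `R/r` only", so that the annulus probabilities become genuinely
  multiplicative across scales): by the PROVED sub-multiplicativity of the lattice probabilities
  (`polyArmProb_submult`, SW §4.2 first display / p. 5 (4) left) and monotonicity in the inner
  radius (`armEvent_mono_left`), `b₂(ρ, ρnm) ≤ b₂(ρ, ρn) · b₂(2ρn, ρnm)`, whence in the limit
  `L(1, nm) ≤ L(1, n) · L(2, m) ≤ L(1, n) · L(1, ⌊m/2⌋)` (`limit_submul`, `limit_submul_half`);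
  so `i ↦ log L(1, 2^{i-1})` (`i ≥ 2`, and `0` for `i ≤ 1`) is subadditive
  (`subadditive_log_limit_dyadic`), `log L(1, 2^{i-1}) / i` is bounded below by the RSW a-priori
  bound (`exists_rpow_le_limit`, SW p. 9 "`b'_j(R) ≥ const R^{-ζ}`"), Fekete's lemma (Mathlib
  `Subadditive.tendsto_lim`) gives the exponent along the powers of `2`, and the monotone
  sandwich `L(1, 2^{k+1}) ≤ L(1, n) ≤ L(1, 2^k)` (`limit_anti_right`) gives it along all `n`.
* **The value from any unbounded set of scales.** Consequently the named fact follows from (16)ℕ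
  together with the exponent `-1/4` read along ANY sequence of integer ratios tending to
  infinity (`SmirnovWerner2001_twoArm_scalingLimit_of_limits_subseq`), or merely frequently
  (`…_of_limits_frequently`, with the equivalence `…_iff_limits_frequently`), or from two-sided
  power bounds `c₁ n^{-1/4} ≤ L(1, n) ≤ c₂ n^{-1/4}` on an unbounded set of `n`
  (`…_of_limits_rpow_bounds_frequently`) — the form in which `SLE₆` computations are printed
  (SW (13): "`≍ R^{-ν(λ)}`", and SW's own "unbounded set `ℛ` of radii" in (10)).
* **The value is the lattice exponent.** Given quasi-multiplicativity (B)
  (`Nolin2008_twoArm_quasiMult`), the chains of `ArmExponentsTwoArm.lean` run backwards: the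
  lattice statement `twoArm_exponent` forces `α = -1/4`
  (`TwoArmScalingLimit.neg_quarter_le_exponent` from sub-multiplicativity,
  `TwoArmScalingLimit.exponent_le_neg_quarter` from (B)), so that
  `SmirnovWerner2001_twoArm_scalingLimit ⇔ (16)ℕ ∧ twoArm_exponent` given (B)
  (`SmirnovWerner2001_twoArm_scalingLimit_iff_limits_and_twoArm_exponent`): modulo the existence
  of the scaling limit, fact (A) of `ArmExponentsTwoArm.lean` carries exactly the information of
  the target exponent, no more.

What remains for `SmirnovWerner2001_twoArm_scalingLimit_holds` is unchanged in nature — (16)ℕ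
(Smirnov / Camia–Newman, the named fact `exists_isCNLFamily_tendsto` through
`SmirnovWerner2001_twoArm_scalingLimit_of_cnl_of_lattice`) and the `SLE₆` value `1/4` of the
exponent (SW (9) = (12) + (13) + (15): Lawler–Schramm–Werner's radial annulus exponent
`ν(0) = 1/4`) — but the value is now needed only on an unbounded set of scales.

## References

* S. Smirnov, W. Werner, Math. Res. Lett. 8 (2001) 729–744; arXiv:math/0109120, §3 (4) and
  p. 5, §4 (9), (10), (13), (16) and p. 9 [SmirnovWernerMRL2001].
* M. Fekete, Math. Z. 17 (1923) 228–249 (subadditive lemma; Mathlib `Subadditive.tendsto_lim`).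

## Mathlib / tree

Mathlib: `Subadditive`, `Subadditive.tendsto_lim`, `Nat.log`, `Real.log`, `Filter.Tendsto`,
`tendsto_of_tendsto_of_tendsto_of_le_of_le'`, `tendsto_nhds_unique`, `Filter.Frequently`.
Tree: `critTwoArmProb`, `SmirnovWerner2001_twoArm_scalingLimit`, `Nolin2008_twoArm_quasiMult`,
`TwoArmAssembly.upper_chain/lower_chain/tendsto_affine_div_affine/div_le_div_of_nonpos_left'`,
`twoArm_exponent_of_facts` (`ArmExponentsTwoArm.lean`); `TwoArmScalingLimit.limit_mul`,
`limit_anti_right`, `limit_anti_ratio`, `limit_pos`, `limit_le_one`, `exists_rpow_le_limit`,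
`SmirnovWerner2001_twoArm_scalingLimit_of_limits_nat`, `SmirnovWerner2001_twoArm_scalingLimit_iff`
(`ArmExponentsTwoArmProofs.lean`); `polyArmProb_submult`, `armEvent_mono_left`,
`polyArmProb_nonneg`, `polyArmProb_le_one`, `polyArmProb_twoArm_pos` (`ArmEventsProofs.lean`);
`twoArm_exponent`, `HasArmExponent` (`ArmExponents.lean`, `ArmEvents.lean`).
-/

noncomputable section

open Filter Topology MeasureTheory

namespace Literature.Probability.Percolation

open LatticeModels

namespace TwoArmScalingLimit

variable {L : ℕ → ℕ → ℝ}

/-! ### Sub-multiplicativity of the limits (SW §4.2, first display of the proof of (10)) -/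

/-- **Sub-multiplicativity across the scale `ρ n`, lattice form**:
`b₂(ρ, ρ n m) ≤ b₂(ρ, ρ n) · b₂(2 ρ n, ρ n m)` (`ρ, n ≥ 1`, `m ≥ 2`): truncation of the arms at
`∂Λ_{ρn}` and independence of the disjoint annuli (`polyArmProb_submult`), then monotonicity in
the inner radius `ρ n + 1 ≤ 2 ρ n` (`armEvent_mono_left`).
[cite: SmirnovWernerMRL2001, §4.2 proof of (10), first inequality] -/
theorem critTwoArmProb_submul_two {ρ n m : ℕ} (hρ : 1 ≤ ρ) (hn : 1 ≤ n) (hm : 2 ≤ m) :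
    critTwoArmProb (ρ * 1) (ρ * (n * m)) ≤
      critTwoArmProb (ρ * 1) (ρ * n) * critTwoArmProb (ρ * (2 * n)) (ρ * (n * m)) := by
  have hρn : 1 ≤ ρ * n := le_trans hρ (Nat.le_mul_of_pos_right ρ hn)
  have h12 : ρ * 1 ≤ ρ * n := Nat.mul_le_mul_left ρ hn
  have h2n : ρ * (2 * n) = ρ * n * 2 := by ring
  have hnm : ρ * (n * m) = ρ * n * m := by ring
  have h23 : ρ * n < ρ * (n * m) := by
    rw [hnm]
    calc ρ * n < ρ * n * 2 := by omega
      _ ≤ ρ * n * m := Nat.mul_le_mul_left (ρ * n) hm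
  have hA : ρ * n + 1 ≤ ρ * (2 * n) := by rw [h2n]; omega
  have hB : ρ * (2 * n) ≤ ρ * (n * m) := by
    rw [h2n, hnm]
    exact Nat.mul_le_mul_left (ρ * n) hm
  calc critTwoArmProb (ρ * 1) (ρ * (n * m))
      ≤ critTwoArmProb (ρ * 1) (ρ * n) * critTwoArmProb (ρ * n + 1) (ρ * (n * m)) :=
        polyArmProb_submult ![true, false] h12 h23
    _ ≤ critTwoArmProb (ρ * 1) (ρ * n) * critTwoArmProb (ρ * (2 * n)) (ρ * (n * m)) := by
        apply mul_le_mul_of_nonneg_left _ (polyArmProb_nonneg _ _ _)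
        simp only [critTwoArmProb, polyArmProb]
        exact measureReal_mono (armEvent_mono_left _ hA hB) (measure_ne_top _ _)

/-- **Sub-multiplicativity of the limits**: `L(1, n m) ≤ L(1, n) · L(2, m)` for `n ≥ 2`, `m ≥ 3`
(pass to the limit `ρ → ∞` in `critTwoArmProb_submul_two`; `b₂(2ρn, ρnm) → L(2n, nm) = L(2, m)`
by the ratio-only dependence `limit_mul`). [cite: SmirnovWernerMRL2001, §4.2 proof of (10) and (16)] -/
theorem limit_submul
    (hlim : ∀ r R : ℕ, 1 ≤ r → r < R →
      Tendsto (fun ρ : ℕ => critTwoArmProb (ρ * r) (ρ * R)) atTop (𝓝 (L r R)))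
    {n m : ℕ} (hn : 2 ≤ n) (hm : 3 ≤ m) : L 1 (n * m) ≤ L 1 n * L 2 m := by
  have hnm : 1 < n * m := lt_of_lt_of_le (by norm_num : 1 < 2 * 3) (Nat.mul_le_mul hn hm)
  have h1 : Tendsto (fun ρ : ℕ => critTwoArmProb (ρ * 1) (ρ * (n * m))) atTop (𝓝 (L 1 (n * m))) :=
    hlim 1 (n * m) le_rfl hnm
  have h2 : Tendsto (fun ρ : ℕ => critTwoArmProb (ρ * 1) (ρ * n)) atTop (𝓝 (L 1 n)) :=
    hlim 1 n le_rfl (by omega)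
  have h3 : Tendsto (fun ρ : ℕ => critTwoArmProb (ρ * (2 * n)) (ρ * (n * m))) atTop (𝓝 (L 2 m)) := by
    have h := hlim (n * 2) (n * m) (by omega) (Nat.mul_lt_mul_of_pos_left (by omega) (by omega))
    rw [limit_mul hlim (by norm_num) (by omega) (by omega)] at h
    exact Tendsto.congr (fun ρ => by rw [Nat.mul_comm n 2]) h
  refine le_of_tendsto_of_tendsto h1 (h2.mul h3) ?_
  filter_upwards [eventually_ge_atTop 1] with ρ hρ
  exact critTwoArmProb_submul_two hρ (by omega) (by omega)

/-- `L(1, n m) ≤ L(1, n) · L(1, ⌊m/2⌋)` for `n ≥ 2`, `m ≥ 4` (`L(2, m) ≤ L(1, ⌊m/2⌋)`, the limits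
being non-increasing in the ratio, `limit_anti_ratio`). [cite: SmirnovWernerMRL2001, §4.2 proof of (10) and (16)] -/
theorem limit_submul_half
    (hlim : ∀ r R : ℕ, 1 ≤ r → r < R →
      Tendsto (fun ρ : ℕ => critTwoArmProb (ρ * r) (ρ * R)) atTop (𝓝 (L r R)))
    {n m : ℕ} (hn : 2 ≤ n) (hm : 4 ≤ m) : L 1 (n * m) ≤ L 1 n * L 1 (m / 2) := by
  have h := limit_submul hlim (m := m) hn (by omega)
  have h2 : L 2 m ≤ L 1 (m / 2) :=
    limit_anti_ratio hlim (r := 1) (R := m / 2) (r' := 2) (R' := m) le_rfl (by omega) (by norm_num)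
      (by omega) (by omega)
  exact h.trans (mul_le_mul_of_nonneg_left h2 (limit_pos hlim le_rfl (by omega)).le)

/-- Powers of two are at least two from exponent one on. [folklore] -/
theorem one_lt_two_pow' {i : ℕ} (hi : 1 ≤ i) : 1 < 2 ^ i := by
  have := Nat.le_self_pow (by omega : i ≠ 0) 2
  omega

/-- **Dyadic subadditivity**: `log L(1, 2^{j+k}) ≤ log L(1, 2^j) + log L(1, 2^{k-1})` for
`j ≥ 1`, `k ≥ 2`. [cite: SmirnovWernerMRL2001, §4.2 proof of (10) and (16)] -/
theorem log_limit_dyadic_subadd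
    (hlim : ∀ r R : ℕ, 1 ≤ r → r < R →
      Tendsto (fun ρ : ℕ => critTwoArmProb (ρ * r) (ρ * R)) atTop (𝓝 (L r R)))
    {j k : ℕ} (hj : 1 ≤ j) (hk : 2 ≤ k) :
    Real.log (L 1 (2 ^ (j + k))) ≤ Real.log (L 1 (2 ^ j)) + Real.log (L 1 (2 ^ (k - 1))) := by
  have hn : 2 ≤ 2 ^ j := Nat.le_self_pow (by omega) 2
  have hm : 4 ≤ 2 ^ k :=
    calc 4 = 2 ^ 2 := by norm_num
      _ ≤ 2 ^ k := Nat.pow_le_pow_right (by norm_num) hk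
  have h := limit_submul_half hlim hn hm
  have hdiv : 2 ^ k / 2 = 2 ^ (k - 1) := by
    obtain ⟨k', rfl⟩ : ∃ k', k = k' + 1 := ⟨k - 1, by omega⟩
    rw [Nat.add_sub_cancel, Nat.pow_succ, Nat.mul_div_cancel _ (by norm_num)]
  rw [← pow_add, hdiv] at h
  have hpos1 : 0 < L 1 (2 ^ j) := limit_pos hlim le_rfl (one_lt_two_pow' hj)
  have hpos2 : 0 < L 1 (2 ^ (k - 1)) := limit_pos hlim le_rfl (one_lt_two_pow' (by omega))
  have hpos : 0 < L 1 (2 ^ (j + k)) := limit_pos hlim le_rfl (one_lt_two_pow' (by omega))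
  rw [← Real.log_mul hpos1.ne' hpos2.ne']
  exact Real.log_le_log hpos h

/-- **The Fekete sequence is subadditive**: `u(i) = log L(1, 2^{i-1})` for `i ≥ 2`,
`u(0) = u(1) = 0`, satisfies `u(m + n) ≤ u(m) + u(n)` (dyadic subadditivity for `m, n ≥ 2`;
monotonicity `L(1, 2^{i+1}) ≤ L(1, 2^i)` and `L ≤ 1` in the remaining cases). [folklore] -/
theorem subadditive_log_limit_dyadic
    (hlim : ∀ r R : ℕ, 1 ≤ r → r < R →
      Tendsto (fun ρ : ℕ => critTwoArmProb (ρ * r) (ρ * R)) atTop (𝓝 (L r R))) :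
    Subadditive fun i : ℕ => if i ≤ 1 then (0 : ℝ) else Real.log (L 1 (2 ^ (i - 1))) := by
  have hpos : ∀ i : ℕ, 1 ≤ i → 0 < L 1 (2 ^ i) := fun i hi =>
    limit_pos hlim le_rfl (one_lt_two_pow' hi)
  have hnonpos : ∀ i : ℕ, 1 ≤ i → Real.log (L 1 (2 ^ i)) ≤ 0 := fun i hi =>
    Real.log_nonpos (hpos i hi).le (limit_le_one hlim le_rfl (one_lt_two_pow' hi))
  have hmono : ∀ i : ℕ, 1 ≤ i → Real.log (L 1 (2 ^ (i + 1))) ≤ Real.log (L 1 (2 ^ i)) :=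
    fun i hi => Real.log_le_log (hpos (i + 1) (by omega))
      (limit_anti_right hlim le_rfl (one_lt_two_pow' hi)
        (Nat.pow_le_pow_right (by norm_num) (by omega)))
  intro m n
  dsimp only
  by_cases hm : m ≤ 1 <;> by_cases hn : n ≤ 1
  · -- both indices small
    by_cases hmn : m + n ≤ 1
    · rw [if_pos hm, if_pos hn, if_pos hmn, add_zero]
    · have h2 : m + n - 1 = 1 := by omega
      rw [if_pos hm, if_pos hn, if_neg hmn, add_zero, h2]
      exact hnonpos 1 le_rfl
  · -- `m ≤ 1 < n`
    rw [if_pos hm, if_neg hn, if_neg (by omega), zero_add]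
    rcases Nat.le_one_iff_eq_zero_or_eq_one.1 hm with rfl | rfl
    · rw [zero_add]
    · have h' : 1 + n - 1 = (n - 1) + 1 := by omega
      rw [h']
      exact hmono (n - 1) (by omega)
  · -- `n ≤ 1 < m`
    rw [if_neg hm, if_pos hn, if_neg (by omega), add_zero]
    rcases Nat.le_one_iff_eq_zero_or_eq_one.1 hn with rfl | rfl
    · rw [add_zero]
    · have h' : m + 1 - 1 = (m - 1) + 1 := by omega
      rw [h']
      exact hmono (m - 1) (by omega)
  · -- `m, n ≥ 2`
    rw [if_neg hm, if_neg hn, if_neg (by omega)]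
    have h := log_limit_dyadic_subadd hlim (j := m - 1) (k := n) (by omega) (by omega)
    have h' : m + n - 1 = m - 1 + n := by omega
    rwa [h']

/-- **The exponent exists along the powers of two** (Fekete's lemma for the subadditive
sequence `log L(1, 2^{i-1})`, bounded below by the RSW a-priori bound `L(1, R) ≥ c R^{-ζ}`).
[cite: SmirnovWernerMRL2001, §4.2 (16) and the sentence following it (p. 9)] -/
theorem exists_tendsto_log_limit_dyadic
    (hlim : ∀ r R : ℕ, 1 ≤ r → r < R →
      Tendsto (fun ρ : ℕ => critTwoArmProb (ρ * r) (ρ * R)) atTop (𝓝 (L r R))) :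
    ∃ α : ℝ, Tendsto (fun k : ℕ => Real.log (L 1 (2 ^ k)) / Real.log ((2 : ℝ) ^ k)) atTop (𝓝 α) := by
  set u : ℕ → ℝ := fun i : ℕ => if i ≤ 1 then (0 : ℝ) else Real.log (L 1 (2 ^ (i - 1))) with hu
  have hsub : Subadditive u := subadditive_log_limit_dyadic hlim
  obtain ⟨c, ζ, hc, hζ, hlow⟩ := exists_rpow_le_limit hlim
  have hlog2 : 0 < Real.log 2 := Real.log_pos (by norm_num)
  -- `u i / i` is bounded below
  have hbdd : BddBelow (Set.range fun i => u i / i) := by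
    refine ⟨-(|Real.log c| + ζ * Real.log 2), ?_⟩
    rintro _ ⟨i, rfl⟩
    by_cases hi : i ≤ 1
    · have hu0 : u i = 0 := by rw [hu]; exact if_pos hi
      simp only [hu0, zero_div]
      have : 0 ≤ |Real.log c| + ζ * Real.log 2 := by positivity
      linarith
    · have hi2 : 2 ≤ i := by omega
      have hu1 : u i = Real.log (L 1 (2 ^ (i - 1))) := by rw [hu]; exact if_neg (by omega)
      have hi1 : (1 : ℝ) ≤ i := by exact_mod_cast (show 1 ≤ i by omega)
      have hipos : (0 : ℝ) < i := by linarith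
      have hpow1 : 1 < 2 ^ (i - 1) := one_lt_two_pow' (by omega)
      have hL := hlow 1 (2 ^ (i - 1)) le_rfl hpow1
      have hLpos : 0 < L 1 (2 ^ (i - 1)) := limit_pos hlim le_rfl hpow1
      have hbase : (0 : ℝ) < ((1 : ℕ) : ℝ) / ((2 ^ (i - 1) : ℕ) : ℝ) := by positivity
      have hlogL : Real.log c + ζ * Real.log (((1 : ℕ) : ℝ) / ((2 ^ (i - 1) : ℕ) : ℝ)) ≤ u i := by
        rw [hu1, ← Real.log_rpow hbase, ← Real.log_mul hc.ne' (Real.rpow_pos_of_pos hbase _).ne']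
        exact Real.log_le_log (mul_pos hc (Real.rpow_pos_of_pos hbase _)) hL
      have hlogq : Real.log (((1 : ℕ) : ℝ) / ((2 ^ (i - 1) : ℕ) : ℝ)) = -(((i - 1 : ℕ) : ℝ) * Real.log 2) := by
        push_cast
        rw [one_div, Real.log_inv, Real.log_pow]
      rw [hlogq] at hlogL
      have hi1' : ((i - 1 : ℕ) : ℝ) = (i : ℝ) - 1 := by
        rw [Nat.cast_sub (show 1 ≤ i by omega), Nat.cast_one]
      rw [hi1'] at hlogL
      simp only
      rw [le_div_iff₀ hipos]
      have h1 : -|Real.log c| ≤ Real.log c := neg_abs_le _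
      have h2 : |Real.log c| ≤ |Real.log c| * i := le_mul_of_one_le_right (abs_nonneg _) hi1
      have h3 : 0 ≤ ζ * Real.log 2 := by positivity
      nlinarith
  refine ⟨hsub.lim / Real.log 2, ?_⟩
  have hF : Tendsto (fun i : ℕ => u i / i) atTop (𝓝 hsub.lim) := hsub.tendsto_lim hbdd
  have h1 : Tendsto (fun k : ℕ => u (k + 1) / ((k + 1 : ℕ) : ℝ)) atTop (𝓝 hsub.lim) :=
    hF.comp (tendsto_add_atTop_nat 1)
  have h2 : Tendsto (fun k : ℕ => ((k + 1 : ℕ) : ℝ) / (k : ℝ)) atTop (𝓝 1) := by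
    have h : Tendsto (fun k : ℕ => 1 + 1 / (k : ℝ)) atTop (𝓝 (1 + 0)) :=
      tendsto_const_nhds.add tendsto_one_div_atTop_nhds_zero_nat
    rw [add_zero] at h
    refine h.congr' ?_
    filter_upwards [eventually_ge_atTop 1] with k hk
    have hk' : (0 : ℝ) < k := by exact_mod_cast hk
    push_cast
    field_simp
  have h3 := (h1.mul h2).div_const (Real.log 2)
  rw [mul_one] at h3
  refine h3.congr' ?_
  filter_upwards [eventually_ge_atTop 1] with k hk
  have hk' : (0 : ℝ) < k := by exact_mod_cast hk
  have hu' : u (k + 1) = Real.log (L 1 (2 ^ k)) := by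
    rw [hu]
    simp only
    rw [if_neg (by omega), Nat.add_sub_cancel]
  rw [hu', Real.log_pow]
  push_cast
  field_simp

/-- The integer binary logarithm tends to infinity. [folklore] -/
theorem tendsto_nat_log_two_atTop : Tendsto (fun n : ℕ => Nat.log 2 n) atTop atTop :=
  tendsto_atTop_atTop.2 fun k => ⟨2 ^ k, fun n hn => Nat.le_log_of_pow_le (by norm_num) hn⟩

/-- **Existence of the exponent of the scaling limit.** If the two-arm probabilities of the
integer annuli converge, `b₂(ρ r, ρ R) → L(r, R)` for all `1 ≤ r < R` (SW (16) on integer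
data), then `log L(1, n) / log n` converges: the limit function `λ ↦ b'(λ)` has an exponent.
(Fekete along the powers of two, `exists_tendsto_log_limit_dyadic`, and the monotone sandwich
`L(1, 2^{k+1}) ≤ L(1, n) ≤ L(1, 2^k)` for `2^k ≤ n < 2^{k+1}`.)
[cite: SmirnovWernerMRL2001, §4.2 (16) and p. 9] -/
theorem exists_tendsto_log_limit_div_log
    (hlim : ∀ r R : ℕ, 1 ≤ r → r < R →
      Tendsto (fun ρ : ℕ => critTwoArmProb (ρ * r) (ρ * R)) atTop (𝓝 (L r R))) :
    ∃ α : ℝ, Tendsto (fun n : ℕ => Real.log (L 1 n) / Real.log n) atTop (𝓝 α) := by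
  obtain ⟨α, hα⟩ := exists_tendsto_log_limit_dyadic hlim
  refine ⟨α, ?_⟩
  have hlog2 : 0 < Real.log 2 := Real.log_pos (by norm_num)
  -- the upper comparison sequence `log L(1, 2^k) / ((k + 1) log 2) → α`
  have hU : Tendsto (fun k : ℕ => Real.log (L 1 (2 ^ k)) / (((k : ℝ) + 1) * Real.log 2)) atTop (𝓝 α) := by
    have h2 : Tendsto (fun k : ℕ => (k : ℝ) / ((k : ℝ) + 1)) atTop (𝓝 1) := by
      have h := TwoArmAssembly.tendsto_affine_div_affine 1 0 1 1 one_ne_zero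
      rw [div_one] at h
      refine h.congr' (Eventually.of_forall fun k => ?_)
      simp
    have h := hα.mul h2
    rw [mul_one] at h
    refine h.congr' ?_
    filter_upwards [eventually_ge_atTop 1] with k hk
    have hk' : (0 : ℝ) < k := by exact_mod_cast hk
    rw [Real.log_pow]
    field_simp
  -- the lower comparison sequence `log L(1, 2^{k+1}) / (k log 2) → α`
  have hV : Tendsto (fun k : ℕ => Real.log (L 1 (2 ^ (k + 1))) / ((k : ℝ) * Real.log 2)) atTop (𝓝 α) := by
    have h1 : Tendsto (fun k : ℕ => Real.log (L 1 (2 ^ (k + 1))) / Real.log ((2 : ℝ) ^ (k + 1))) atTop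
        (𝓝 α) := hα.comp (tendsto_add_atTop_nat 1)
    have h2 : Tendsto (fun k : ℕ => ((k : ℝ) + 1) / (k : ℝ)) atTop (𝓝 1) := by
      have h : Tendsto (fun k : ℕ => 1 + 1 / (k : ℝ)) atTop (𝓝 (1 + 0)) :=
        tendsto_const_nhds.add tendsto_one_div_atTop_nhds_zero_nat
      rw [add_zero] at h
      refine h.congr' ?_
      filter_upwards [eventually_ge_atTop 1] with k hk
      have hk' : (0 : ℝ) < k := by exact_mod_cast hk
      field_simp
    have h := h1.mul h2
    rw [mul_one] at h
    refine h.congr' ?_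
    filter_upwards [eventually_ge_atTop 1] with k hk
    have hk' : (0 : ℝ) < k := by exact_mod_cast hk
    rw [Real.log_pow]
    push_cast
    field_simp
  have hV' : Tendsto (fun n : ℕ => Real.log (L 1 (2 ^ (Nat.log 2 n + 1))) / ((Nat.log 2 n : ℝ) * Real.log 2))
      atTop (𝓝 α) := hV.comp tendsto_nat_log_two_atTop
  have hU' : Tendsto (fun n : ℕ => Real.log (L 1 (2 ^ Nat.log 2 n)) / (((Nat.log 2 n : ℝ) + 1) * Real.log 2))
      atTop (𝓝 α) := hU.comp tendsto_nat_log_two_atTop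
  refine tendsto_of_tendsto_of_tendsto_of_le_of_le' hV' hU' ?_ ?_
  · -- lower bound
    filter_upwards [eventually_ge_atTop 2] with n hn
    set k := Nat.log 2 n with hk
    have hk1 : 1 ≤ k := Nat.le_log_of_pow_le (by norm_num) (by simpa using hn)
    have hnk : n < 2 ^ (k + 1) := Nat.lt_pow_succ_log_self (by norm_num) n
    have hkn : 2 ^ k ≤ n := Nat.pow_log_le_self 2 (by omega)
    have hlow : L 1 (2 ^ (k + 1)) ≤ L 1 n := limit_anti_right hlim le_rfl (by omega) hnk.le
    have hposn : 0 < L 1 n := limit_pos hlim le_rfl (by omega)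
    have hpos1 : 0 < L 1 (2 ^ (k + 1)) := limit_pos hlim le_rfl (by omega)
    have hnum : Real.log (L 1 (2 ^ (k + 1))) ≤ 0 :=
      Real.log_nonpos hpos1.le (limit_le_one hlim le_rfl (by omega))
    have hn1 : (1 : ℝ) < n := by exact_mod_cast (show 1 < n by omega)
    have hlogn_pos : 0 < Real.log (n : ℝ) := Real.log_pos hn1
    have hklog_pos : 0 < (k : ℝ) * Real.log 2 := mul_pos (by exact_mod_cast hk1) hlog2
    have hlogn_ge : (k : ℝ) * Real.log 2 ≤ Real.log (n : ℝ) := by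
      have h : (2 : ℝ) ^ k ≤ n := by exact_mod_cast hkn
      have := Real.log_le_log (by positivity) h
      rwa [Real.log_pow] at this
    calc Real.log (L 1 (2 ^ (k + 1))) / ((k : ℝ) * Real.log 2)
        ≤ Real.log (L 1 (2 ^ (k + 1))) / Real.log n :=
          TwoArmAssembly.div_le_div_of_nonpos_left' hnum hklog_pos hlogn_ge
      _ ≤ Real.log (L 1 n) / Real.log n :=
          div_le_div_of_nonneg_right (Real.log_le_log hpos1 hlow) hlogn_pos.le
  · -- upper bound
    filter_upwards [eventually_ge_atTop 2] with n hn
    set k := Nat.log 2 n with hk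
    have hk1 : 1 ≤ k := Nat.le_log_of_pow_le (by norm_num) (by simpa using hn)
    have hnk : n < 2 ^ (k + 1) := Nat.lt_pow_succ_log_self (by norm_num) n
    have hkn : 2 ^ k ≤ n := Nat.pow_log_le_self 2 (by omega)
    have hpowk : 1 < 2 ^ k := one_lt_two_pow' hk1
    have hup : L 1 n ≤ L 1 (2 ^ k) := limit_anti_right hlim le_rfl hpowk hkn
    have hposn : 0 < L 1 n := limit_pos hlim le_rfl (by omega)
    have hposk : 0 < L 1 (2 ^ k) := limit_pos hlim le_rfl hpowk
    have hnum : Real.log (L 1 (2 ^ k)) ≤ 0 :=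
      Real.log_nonpos hposk.le (limit_le_one hlim le_rfl hpowk)
    have hn1 : (1 : ℝ) < n := by exact_mod_cast (show 1 < n by omega)
    have hlogn_pos : 0 < Real.log (n : ℝ) := Real.log_pos hn1
    have hlogn_le : Real.log (n : ℝ) ≤ ((k : ℝ) + 1) * Real.log 2 := by
      have h : (n : ℝ) ≤ (2 : ℝ) ^ (k + 1) := by exact_mod_cast hnk.le
      have := Real.log_le_log (by positivity) h
      rw [Real.log_pow] at this
      push_cast at this
      exact this
    calc Real.log (L 1 n) / Real.log n ≤ Real.log (L 1 (2 ^ k)) / Real.log n :=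
          div_le_div_of_nonneg_right (Real.log_le_log hposn hup) hlogn_pos.le
      _ ≤ Real.log (L 1 (2 ^ k)) / (((k : ℝ) + 1) * Real.log 2) :=
          TwoArmAssembly.div_le_div_of_nonpos_left' hnum hlogn_pos hlogn_le

/-- The exponent of the scaling limit is negative: `α ≤ -α₀ < 0` for the a-priori exponent `α₀`
of `exists_limit_le_rpow` (`L(1, n) ≤ C n^{-α₀}`). [cite: Nolin2008, Prop. 14 (arXiv 0711.4948: Prop. 13)] -/
theorem exponent_neg
    (hlim : ∀ r R : ℕ, 1 ≤ r → r < R →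
      Tendsto (fun ρ : ℕ => critTwoArmProb (ρ * r) (ρ * R)) atTop (𝓝 (L r R)))
    {α : ℝ} (hα : Tendsto (fun n : ℕ => Real.log (L 1 n) / Real.log n) atTop (𝓝 α)) : α < 0 := by
  obtain ⟨C, α₀, hC, hα₀, h⟩ := exists_limit_le_rpow hlim
  -- `log L(1, n) / log n ≤ (log C - α₀ log n) / log n → -α₀`
  have hlogn : Tendsto (fun n : ℕ => Real.log (n : ℝ)) atTop atTop :=
    Real.tendsto_log_atTop.comp tendsto_natCast_atTop_atTop
  have hB : Tendsto (fun n : ℕ => Real.log C / Real.log (n : ℝ) + -α₀) atTop (𝓝 (0 + -α₀)) :=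
    (tendsto_const_nhds.div_atTop hlogn).add tendsto_const_nhds
  rw [zero_add] at hB
  have hle : α ≤ -α₀ := by
    refine le_of_tendsto_of_tendsto hα hB ?_
    filter_upwards [eventually_ge_atTop 2] with n hn
    have hn1 : (1 : ℝ) < n := by exact_mod_cast (show 1 < n by omega)
    have hn0 : (0 : ℝ) < n := by linarith
    have hlogn_pos : 0 < Real.log (n : ℝ) := Real.log_pos hn1
    have hpos : 0 < L 1 n := limit_pos hlim le_rfl (by omega)
    have hb := h 1 n le_rfl (by omega)
    have hq : ((1 : ℕ) : ℝ) / (n : ℝ) = (n : ℝ)⁻¹ := by push_cast; rw [one_div]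
    rw [hq] at hb
    have hlog : Real.log (L 1 n) ≤ Real.log C + -α₀ * Real.log n := by
      have := Real.log_le_log hpos hb
      rwa [Real.log_mul hC.ne' (Real.rpow_pos_of_pos (inv_pos.2 hn0) _).ne', Real.log_rpow (inv_pos.2 hn0),
        Real.log_inv, mul_neg, ← neg_mul] at this
    calc Real.log (L 1 n) / Real.log n ≤ (Real.log C + -α₀ * Real.log n) / Real.log n :=
          div_le_div_of_nonneg_right hlog hlogn_pos.le
      _ = Real.log C / Real.log n + -α₀ := by field_simp
  linarith

end TwoArmScalingLimit

/-! ### The named fact from (16)ℕ and the value of the exponent on an unbounded set of scales -/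

open TwoArmScalingLimit in
/-- **The fact from (16)ℕ and the exponent along a subsequence.** If the two-arm probabilities
of the integer annuli converge, `b₂(ρ r, ρ R) → L(r, R)` for all `1 ≤ r < R` (SW (16)), and
`log L(1, φ k) / log (φ k) → -1/4` along SOME sequence of integer ratios `φ k → ∞` (SW (9) with
(15), `j = 2`, on an unbounded set of scales), then `SmirnovWerner2001_twoArm_scalingLimit`
holds: the exponent exists along all integers by `exists_tendsto_log_limit_div_log`, and is
identified along `φ`. [cite: SmirnovWernerMRL2001, §4 (9), (15), (16)] -/
theorem SmirnovWerner2001_twoArm_scalingLimit_of_limits_subseq (L : ℕ → ℕ → ℝ)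
    (hlim : ∀ r R : ℕ, 1 ≤ r → r < R →
      Tendsto (fun ρ : ℕ => critTwoArmProb (ρ * r) (ρ * R)) atTop (𝓝 (L r R)))
    (φ : ℕ → ℕ) (hφ : Tendsto φ atTop atTop)
    (hexp : Tendsto (fun k : ℕ => Real.log (L 1 (φ k)) / Real.log (φ k)) atTop (𝓝 (-(1 / 4)))) :
    SmirnovWerner2001_twoArm_scalingLimit := by
  obtain ⟨α, hα⟩ := exists_tendsto_log_limit_div_log hlim
  have h : Tendsto (fun k : ℕ => Real.log (L 1 (φ k)) / Real.log (φ k)) atTop (𝓝 α) := hα.comp hφ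
  have hαeq : α = -(1 / 4) := tendsto_nhds_unique h hexp
  rw [hαeq] at hα
  exact SmirnovWerner2001_twoArm_scalingLimit_of_limits_nat L hlim hα

open TwoArmScalingLimit in
/-- **The fact from (16)ℕ and the exponent read frequently.** If the limits of (16)ℕ exist and
for every `ε > 0` there are arbitrarily large `n` with `|log L(1, n) / log n + 1/4| < ε`, then
`SmirnovWerner2001_twoArm_scalingLimit` holds (the exponent exists, so `-1/4` is its only
cluster value). [cite: SmirnovWernerMRL2001, §4 (9), (15), (16)] -/
theorem SmirnovWerner2001_twoArm_scalingLimit_of_limits_frequently (L : ℕ → ℕ → ℝ)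
    (hlim : ∀ r R : ℕ, 1 ≤ r → r < R →
      Tendsto (fun ρ : ℕ => critTwoArmProb (ρ * r) (ρ * R)) atTop (𝓝 (L r R)))
    (hexp : ∀ ε > 0, ∃ᶠ n : ℕ in atTop, |Real.log (L 1 n) / Real.log n - (-(1 / 4))| < ε) :
    SmirnovWerner2001_twoArm_scalingLimit := by
  obtain ⟨α, hα⟩ := exists_tendsto_log_limit_div_log hlim
  have hαeq : α = -(1 / 4) := by
    by_contra hne
    have hd : 0 < |α - (-(1 / 4))| := abs_pos.2 (sub_ne_zero.2 hne)
    set ε : ℝ := |α - (-(1 / 4))| / 2 with hε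
    have hεpos : 0 < ε := by positivity
    have hev : ∀ᶠ n : ℕ in atTop, |Real.log (L 1 n) / Real.log n - α| < ε := by
      have := (Metric.tendsto_nhds.1 hα) ε hεpos
      simpa only [Real.dist_eq] using this
    obtain ⟨n, hn1, hn2⟩ := ((hexp ε hεpos).and_eventually hev).exists
    have h3 : |α - (-(1 / 4))| < 2 * ε := by
      rw [abs_sub_lt_iff] at hn1 hn2 ⊢
      constructor <;> linarith [hn1.1, hn1.2, hn2.1, hn2.2]
    rw [hε] at h3
    linarith
  rw [hαeq] at hα
  exact SmirnovWerner2001_twoArm_scalingLimit_of_limits_nat L hlim hα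

/-- **`SmirnovWerner2001_twoArm_scalingLimit` ⇔ (16)ℕ ∧ "exponent `-1/4` frequently".** The
named fact is equivalent to: the two-arm probabilities of the integer annuli converge, and
`-1/4` is a cluster value of `log L(1, n) / log n`. [cite: SmirnovWernerMRL2001, §4 (9), (15), (16)] -/
theorem SmirnovWerner2001_twoArm_scalingLimit_iff_limits_frequently :
    SmirnovWerner2001_twoArm_scalingLimit ↔ ∃ L : ℕ → ℕ → ℝ,
      (∀ r R : ℕ, 1 ≤ r → r < R →
        Tendsto (fun ρ : ℕ => critTwoArmProb (ρ * r) (ρ * R)) atTop (𝓝 (L r R))) ∧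
      ∀ ε > 0, ∃ᶠ n : ℕ in atTop, |Real.log (L 1 n) / Real.log n - (-(1 / 4))| < ε := by
  constructor
  · intro h
    obtain ⟨L, hlim, hexp⟩ := SmirnovWerner2001_twoArm_scalingLimit_iff.1 h
    refine ⟨L, hlim, fun ε hε => Eventually.frequently ?_⟩
    have := (Metric.tendsto_nhds.1 hexp) ε hε
    simpa only [Real.dist_eq] using this
  · rintro ⟨L, hlim, hexp⟩
    exact SmirnovWerner2001_twoArm_scalingLimit_of_limits_frequently L hlim hexp

open TwoArmScalingLimit in
/-- **The fact from (16)ℕ and two-sided power bounds on an unbounded set of scales.** If the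
limits of (16)ℕ exist and `c₁ n^{-1/4} ≤ L(1, n) ≤ c₂ n^{-1/4}` for arbitrarily large `n`
(`c₁ > 0`; the shape "`≍ R^{-ν(0)}`, `ν(0) = 1/4`" of the radial `SLE₆` estimate SW (13), on an
unbounded set of radii as in SW (10)), then `SmirnovWerner2001_twoArm_scalingLimit` holds.
[cite: SmirnovWernerMRL2001, §4 (9), (10), (13), (16)] -/
theorem SmirnovWerner2001_twoArm_scalingLimit_of_limits_rpow_bounds_frequently (L : ℕ → ℕ → ℝ)
    (hlim : ∀ r R : ℕ, 1 ≤ r → r < R →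
      Tendsto (fun ρ : ℕ => critTwoArmProb (ρ * r) (ρ * R)) atTop (𝓝 (L r R)))
    {c₁ c₂ : ℝ} (hc₁ : 0 < c₁)
    (hb : ∃ᶠ n : ℕ in atTop, c₁ * (n : ℝ) ^ (-(1 / 4) : ℝ) ≤ L 1 n ∧ L 1 n ≤ c₂ * (n : ℝ) ^ (-(1 / 4) : ℝ)) :
    SmirnovWerner2001_twoArm_scalingLimit := by
  have hc₂ : 0 < c₂ := by
    obtain ⟨n, ⟨h1, h2⟩, hn⟩ := (hb.and_eventually (eventually_ge_atTop 1)).exists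
    have hn0 : (0 : ℝ) < n := by exact_mod_cast hn
    have hr : (0 : ℝ) < (n : ℝ) ^ (-(1 / 4) : ℝ) := Real.rpow_pos_of_pos hn0 _
    have : 0 < c₂ * (n : ℝ) ^ (-(1 / 4) : ℝ) := lt_of_lt_of_le (mul_pos hc₁ hr) (h1.trans h2)
    exact pos_of_mul_pos_left this hr.le
  refine SmirnovWerner2001_twoArm_scalingLimit_of_limits_frequently L hlim fun ε hε => ?_
  have hlogn : Tendsto (fun n : ℕ => Real.log (n : ℝ)) atTop atTop :=
    Real.tendsto_log_atTop.comp tendsto_natCast_atTop_atTop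
  have h1 : Tendsto (fun n : ℕ => Real.log c₁ / Real.log (n : ℝ)) atTop (𝓝 0) :=
    tendsto_const_nhds.div_atTop hlogn
  have h2 : Tendsto (fun n : ℕ => Real.log c₂ / Real.log (n : ℝ)) atTop (𝓝 0) :=
    tendsto_const_nhds.div_atTop hlogn
  have hev1 : ∀ᶠ n : ℕ in atTop, |Real.log c₁ / Real.log (n : ℝ) - 0| < ε := by
    have := (Metric.tendsto_nhds.1 h1) ε hε
    simpa only [Real.dist_eq] using this
  have hev2 : ∀ᶠ n : ℕ in atTop, |Real.log c₂ / Real.log (n : ℝ) - 0| < ε := by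
    have := (Metric.tendsto_nhds.1 h2) ε hε
    simpa only [Real.dist_eq] using this
  refine (hb.and_eventually ((hev1.and hev2).and (eventually_ge_atTop 2))).mono ?_
  rintro n ⟨⟨hlo, hhi⟩, ⟨hε1, hε2⟩, hn⟩
  have hn1 : (1 : ℝ) < n := by exact_mod_cast (show 1 < n by omega)
  have hn0 : (0 : ℝ) < n := by linarith
  have hlogn_pos : 0 < Real.log (n : ℝ) := Real.log_pos hn1
  have hr : (0 : ℝ) < (n : ℝ) ^ (-(1 / 4) : ℝ) := Real.rpow_pos_of_pos hn0 _
  have hpos : 0 < L 1 n := lt_of_lt_of_le (mul_pos hc₁ hr) hlo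
  have hlogr : Real.log ((n : ℝ) ^ (-(1 / 4) : ℝ)) = -(1 / 4) * Real.log n := Real.log_rpow hn0 _
  have hlo' : Real.log c₁ + -(1 / 4) * Real.log n ≤ Real.log (L 1 n) := by
    have := Real.log_le_log (mul_pos hc₁ hr) hlo
    rwa [Real.log_mul hc₁.ne' hr.ne', hlogr] at this
  have hhi' : Real.log (L 1 n) ≤ Real.log c₂ + -(1 / 4) * Real.log n := by
    have := Real.log_le_log hpos hhi
    rwa [Real.log_mul hc₂.ne' hr.ne', hlogr] at this
  have hq1 : Real.log c₁ / Real.log n + -(1 / 4) ≤ Real.log (L 1 n) / Real.log n := by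
    rw [div_add' _ _ _ hlogn_pos.ne']
    exact div_le_div_of_nonneg_right hlo' hlogn_pos.le
  have hq2 : Real.log (L 1 n) / Real.log n ≤ Real.log c₂ / Real.log n + -(1 / 4) := by
    rw [div_add' _ _ _ hlogn_pos.ne']
    exact div_le_div_of_nonneg_right hhi' hlogn_pos.le
  rw [sub_zero] at hε1 hε2
  rw [abs_sub_lt_iff]
  rw [abs_lt] at hε1 hε2
  constructor <;> linarith [hε1.1, hε1.2, hε2.1, hε2.2]

/-! ### The value of the exponent is the lattice exponent (the chains of SW p. 5 run backwards) -/

namespace TwoArmScalingLimit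

variable {L : ℕ → ℕ → ℝ}

/-- **Lower bound at a fixed ratio, from sub-multiplicativity and the lattice exponent**: if
`b₂(r₀, R) = R^{-1/4 + o(1)}` (the lattice statement `HasArmExponent`, `r₀ ≥ 1`) and the limits of
(16)ℕ exist, then `-(1/4) log K ≤ log L(2, K)` for every integer ratio `K ≥ 3`: chain the
sub-multiplicative bound `b₂(r₀, K^{j₀+1+d}) ≤ ∏_{m} b₂(2K^m, K^{m+1}) ≤ U^{d+1}`
(`TwoArmAssembly.upper_chain`) beyond the scale where `b₂(2K^m, K^{m+1}) < U = L(2, K) e^ε`, take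
logarithms and let `d → ∞`. [cite: SmirnovWernerMRL2001, §3 proof of Thm. 3 (p. 5) and §4.2] -/
theorem neg_quarter_mul_log_le_log_limit_two
    (hlim : ∀ r R : ℕ, 1 ≤ r → r < R →
      Tendsto (fun ρ : ℕ => critTwoArmProb (ρ * r) (ρ * R)) atTop (𝓝 (L r R)))
    {r₀ : ℕ} (hr₀ : 1 ≤ r₀) (hE : HasArmExponent ![true, false] r₀ (1 / 4))
    {K : ℕ} (hK : 3 ≤ K) : -(1 / 4) * Real.log K ≤ Real.log (L 2 K) := by
  have hK2 : 2 ≤ K := by omega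
  have hK1 : 1 < K := by omega
  have hKR : (3 : ℝ) ≤ K := by exact_mod_cast hK
  have hlogKpos : 0 < Real.log (K : ℝ) := Real.log_pos (by linarith)
  have hL2K : 0 < L 2 K := limit_pos hlim (by norm_num) (by omega)
  have hE0 : Tendsto (fun R : ℕ => Real.log (critTwoArmProb r₀ R) / Real.log R) atTop (𝓝 (-(1 / 4))) := hE
  have hpow_gt : ∀ m : ℕ, m < K ^ m := fun m => Nat.lt_pow_self hK1
  refine le_of_forall_pos_le_add fun ε hε => ?_
  -- the level `U = L(2, K) e^ε > L(2, K)`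
  set U : ℝ := L 2 K * Real.exp ε with hU_def
  have hU0 : 0 < U := mul_pos hL2K (Real.exp_pos ε)
  have hlogU : Real.log U = Real.log (L 2 K) + ε := by
    rw [hU_def, Real.log_mul hL2K.ne' (Real.exp_pos ε).ne', Real.log_exp]
  have hLU : L 2 K < U := by
    have h1 : 1 < Real.exp ε := Real.one_lt_exp_iff.2 hε
    have := mul_lt_mul_of_pos_left h1 hL2K
    rwa [mul_one] at this
  rw [← hlogU]
  rcases le_or_gt 0 (Real.log U) with hU1 | hU1
  · have : -(1 / 4) * Real.log (K : ℝ) ≤ 0 := by nlinarith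
    exact this.trans hU1
  -- the scales beyond which `b₂(2 K^m, K^{m+1}) < U`
  have hconv : Tendsto (fun m : ℕ => critTwoArmProb (K ^ m * 2) (K ^ m * K)) atTop (𝓝 (L 2 K)) :=
    (hlim 2 K (by norm_num) (by omega)).comp (tendsto_pow_atTop_atTop_of_one_lt hK1)
  obtain ⟨m₀, hm₀⟩ := eventually_atTop.1 (hconv.eventually_lt_const hLU)
  set j₀ : ℕ := max m₀ r₀ with hj₀_def
  have hj₀m : m₀ ≤ j₀ := le_max_left _ _
  have hj₀r : r₀ ≤ j₀ := le_max_right _ _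
  have hUm : ∀ m, j₀ ≤ m → critTwoArmProb (2 * K ^ m) (K ^ (m + 1)) ≤ U := fun m hm => by
    have h := hm₀ m (le_trans hj₀m hm)
    rw [mul_comm (K ^ m) 2, ← pow_succ] at h
    exact h.le
  have hchain := TwoArmAssembly.upper_chain hK2 hU0.le hUm
  -- the lattice exponent along `K^(j₀ + 1 + d)`, against the affine bound
  have hsubseq : Tendsto (fun d : ℕ => K ^ (j₀ + 1 + d)) atTop atTop := by
    refine tendsto_atTop_mono (fun d => ?_) tendsto_id
    have := hpow_gt (j₀ + 1 + d)
    simp only [id_eq]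
    omega
  have hE' : Tendsto (fun d : ℕ => Real.log (critTwoArmProb r₀ (K ^ (j₀ + 1 + d))) /
      Real.log (((K ^ (j₀ + 1 + d) : ℕ) : ℝ))) atTop (𝓝 (-(1 / 4))) := hE0.comp hsubseq
  have hB : Tendsto (fun d : ℕ => (Real.log U * d + Real.log U) / (Real.log K * d + ((j₀ : ℝ) + 1) * Real.log K))
      atTop (𝓝 (Real.log U / Real.log K)) :=
    TwoArmAssembly.tendsto_affine_div_affine (Real.log U) (Real.log U) (Real.log K)
      (((j₀ : ℝ) + 1) * Real.log K) hlogKpos.ne'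
  have hle : -(1 / 4) ≤ Real.log U / Real.log K := by
    refine le_of_tendsto_of_tendsto hE' hB (Eventually.of_forall fun d => ?_)
    obtain ⟨n₂, hn₂⟩ : ∃ n₂, n₂ + 1 = 2 * K ^ j₀ := ⟨2 * K ^ j₀ - 1, by have := hpow_gt j₀; omega⟩
    have hKj₀n : 2 * K ^ j₀ ≤ K ^ (j₀ + 1 + d) :=
      calc 2 * K ^ j₀ ≤ K * K ^ j₀ := Nat.mul_le_mul_right _ hK2
        _ = K ^ (j₀ + 1) := by rw [pow_succ, mul_comm]
        _ ≤ K ^ (j₀ + 1 + d) := Nat.pow_le_pow_right (by omega) (by omega)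
    have hb2 : critTwoArmProb r₀ (K ^ (j₀ + 1 + d)) ≤
        critTwoArmProb r₀ n₂ * critTwoArmProb (2 * K ^ j₀) (K ^ (j₀ + 1 + d)) := by
      have h12 : r₀ ≤ n₂ := by have := hpow_gt j₀; omega
      have h23 : n₂ < K ^ (j₀ + 1 + d) := by omega
      have := polyArmProb_submult ![true, false] h12 h23
      rwa [hn₂] at this
    have hb3 : critTwoArmProb (2 * K ^ j₀) (K ^ (j₀ + 1 + d)) ≤ U ^ (d + 1) :=
      hchain d j₀ (j₀ + 1 + d) le_rfl rfl
    have hbU : critTwoArmProb r₀ (K ^ (j₀ + 1 + d)) ≤ U ^ (d + 1) :=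
      calc critTwoArmProb r₀ (K ^ (j₀ + 1 + d))
          ≤ critTwoArmProb r₀ n₂ * critTwoArmProb (2 * K ^ j₀) (K ^ (j₀ + 1 + d)) := hb2
        _ ≤ 1 * U ^ (d + 1) :=
            mul_le_mul (polyArmProb_le_one _ _ _) hb3 (polyArmProb_nonneg _ _ _) zero_le_one
        _ = U ^ (d + 1) := one_mul _
    have hpos : 0 < critTwoArmProb r₀ (K ^ (j₀ + 1 + d)) :=
      polyArmProb_twoArm_pos hr₀ (by have := hpow_gt (j₀ + 1 + d); omega)
    have hlog_le : Real.log (critTwoArmProb r₀ (K ^ (j₀ + 1 + d))) ≤ ((d + 1 : ℕ) : ℝ) * Real.log U := by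
      have := Real.log_le_log hpos hbU
      rwa [Real.log_pow] at this
    have hn0 : (0 : ℝ) < ((j₀ + 1 + d : ℕ) : ℝ) := by exact_mod_cast (show 0 < j₀ + 1 + d by omega)
    have hnlogK_pos : 0 < ((j₀ + 1 + d : ℕ) : ℝ) * Real.log K := mul_pos hn0 hlogKpos
    have hlogKn : Real.log (((K ^ (j₀ + 1 + d) : ℕ) : ℝ)) = ((j₀ + 1 + d : ℕ) : ℝ) * Real.log K := by
      rw [Nat.cast_pow, Real.log_pow]
    show Real.log (critTwoArmProb r₀ (K ^ (j₀ + 1 + d))) / Real.log (((K ^ (j₀ + 1 + d) : ℕ) : ℝ)) ≤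
      (Real.log U * d + Real.log U) / (Real.log K * d + ((j₀ : ℝ) + 1) * Real.log K)
    rw [hlogKn]
    calc Real.log (critTwoArmProb r₀ (K ^ (j₀ + 1 + d))) / (((j₀ + 1 + d : ℕ) : ℝ) * Real.log K)
        ≤ ((d + 1 : ℕ) : ℝ) * Real.log U / (((j₀ + 1 + d : ℕ) : ℝ) * Real.log K) :=
          div_le_div_of_nonneg_right hlog_le hnlogK_pos.le
      _ = (Real.log U * d + Real.log U) / (Real.log K * d + ((j₀ : ℝ) + 1) * Real.log K) := by
          push_cast; ring
  have := (le_div_iff₀ hlogKpos).1 hle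
  linarith

/-- **Upper bound at a fixed ratio, from quasi-multiplicativity and the lattice exponent**: with
the constant `c` and threshold `n₀` of (B), `log c + log L(1, K) ≤ -(1/4) log K` for every
integer ratio `K ≥ 3` (`n₀ ≤ r₀`): chain (B) along the scales `K^m`
(`TwoArmAssembly.lower_chain`) beyond the scale where `b₂(K^m, K^{m+1}) > L' = L(1, K) e^{-ε}`,
take logarithms and let the number of scales tend to infinity.
[cite: SmirnovWernerMRL2001, §3 proof of Thm. 3 (p. 5) and §4 (10)] -/
theorem log_limit_one_le_of_quasiMult
    (hlim : ∀ r R : ℕ, 1 ≤ r → r < R →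
      Tendsto (fun ρ : ℕ => critTwoArmProb (ρ * r) (ρ * R)) atTop (𝓝 (L r R)))
    {c : ℝ} (hc : 0 < c) {n₀ : ℕ}
    (hqm : ∀ n₁ n₂ n₃ : ℕ, n₀ ≤ n₁ → n₁ < n₂ → n₂ < n₃ →
      c * (critTwoArmProb n₁ n₂ * critTwoArmProb n₂ n₃) ≤ critTwoArmProb n₁ n₃)
    {r₀ : ℕ} (hr₀ : 1 ≤ r₀) (hr₀' : n₀ ≤ r₀) (hE : HasArmExponent ![true, false] r₀ (1 / 4))
    {K : ℕ} (hK : 3 ≤ K) : Real.log c + Real.log (L 1 K) ≤ -(1 / 4) * Real.log K := by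
  have hK2 : 2 ≤ K := by omega
  have hK1 : 1 < K := by omega
  have hKR : (3 : ℝ) ≤ K := by exact_mod_cast hK
  have hlogKpos : 0 < Real.log (K : ℝ) := Real.log_pos (by linarith)
  have hL1K : 0 < L 1 K := limit_pos hlim le_rfl hK1
  have hE0 : Tendsto (fun R : ℕ => Real.log (critTwoArmProb r₀ R) / Real.log R) atTop (𝓝 (-(1 / 4))) := hE
  have hpow_gt : ∀ m : ℕ, m < K ^ m := fun m => Nat.lt_pow_self hK1
  suffices h : ∀ ε > 0, Real.log c + (Real.log (L 1 K) - ε) ≤ -(1 / 4) * Real.log K by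
    refine le_of_forall_pos_le_add fun ε hε => ?_
    have := h ε hε
    linarith
  intro ε hε
  -- the level `L' = L(1, K) e^{-ε} < L(1, K)`
  set L' : ℝ := L 1 K * Real.exp (-ε) with hL'_def
  have hL'0 : 0 < L' := mul_pos hL1K (Real.exp_pos _)
  have hlogL' : Real.log L' = Real.log (L 1 K) - ε := by
    rw [hL'_def, Real.log_mul hL1K.ne' (Real.exp_pos _).ne', Real.log_exp]
    ring
  have hL'L : L' < L 1 K := by
    have h1 : Real.exp (-ε) < 1 := Real.exp_lt_one_iff.2 (by linarith)
    exact mul_lt_of_lt_one_right hL1K h1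
  rw [← hlogL']
  -- the scales beyond which `b₂(K^m, K^{m+1}) > L'`
  have hconv : Tendsto (fun m : ℕ => critTwoArmProb (K ^ m * 1) (K ^ m * K)) atTop (𝓝 (L 1 K)) :=
    (hlim 1 K le_rfl hK1).comp (tendsto_pow_atTop_atTop_of_one_lt hK1)
  obtain ⟨m₀, hm₀⟩ := eventually_atTop.1 (hconv.eventually_const_lt hL'L)
  set j₀ : ℕ := max m₀ r₀ with hj₀_def
  have hj₀m : m₀ ≤ j₀ := le_max_left _ _
  have hj₀r : r₀ ≤ j₀ := le_max_right _ _
  have hn₀K : ∀ m, j₀ ≤ m → n₀ ≤ K ^ m := fun m hm => by have := hpow_gt m; omega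
  have hLm : ∀ m, j₀ ≤ m → L' ≤ critTwoArmProb (K ^ m) (K ^ (m + 1)) := fun m hm => by
    have h := hm₀ m (le_trans hj₀m hm)
    rw [mul_one, ← pow_succ] at h
    exact h.le
  have hchain := TwoArmAssembly.lower_chain hc.le hqm hK2 hn₀K hL'0.le hLm
  -- the constant of the first annulus
  set P : ℝ := c * critTwoArmProb r₀ (K ^ j₀) with hP_def
  have hP : 0 < P := mul_pos hc (polyArmProb_twoArm_pos hr₀ (by have := hpow_gt j₀; omega))
  have hsubseq : Tendsto (fun d : ℕ => K ^ (j₀ + 1 + d)) atTop atTop := by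
    refine tendsto_atTop_mono (fun d => ?_) tendsto_id
    have := hpow_gt (j₀ + 1 + d)
    simp only [id_eq]
    omega
  have hE' : Tendsto (fun d : ℕ => Real.log (critTwoArmProb r₀ (K ^ (j₀ + 1 + d))) /
      Real.log (((K ^ (j₀ + 1 + d) : ℕ) : ℝ))) atTop (𝓝 (-(1 / 4))) := hE0.comp hsubseq
  have hB : Tendsto (fun d : ℕ => ((Real.log c + Real.log L') * d + (Real.log P + Real.log L')) /
      (Real.log K * d + ((j₀ : ℝ) + 1) * Real.log K)) atTop
      (𝓝 ((Real.log c + Real.log L') / Real.log K)) :=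
    TwoArmAssembly.tendsto_affine_div_affine _ _ _ _ hlogKpos.ne'
  have hle : (Real.log c + Real.log L') / Real.log K ≤ -(1 / 4) := by
    refine le_of_tendsto_of_tendsto hB hE' (Eventually.of_forall fun d => ?_)
    have hb3 : c ^ d * L' ^ (d + 1) ≤ critTwoArmProb (K ^ j₀) (K ^ (j₀ + 1 + d)) :=
      hchain d j₀ (j₀ + 1 + d) le_rfl rfl
    have hb2 : c * (critTwoArmProb r₀ (K ^ j₀) * critTwoArmProb (K ^ j₀) (K ^ (j₀ + 1 + d))) ≤
        critTwoArmProb r₀ (K ^ (j₀ + 1 + d)) :=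
      hqm _ _ _ hr₀' (by have := hpow_gt j₀; omega) (Nat.pow_lt_pow_right hK1 (by omega))
    have hV : P * (c ^ d * L' ^ (d + 1)) ≤ critTwoArmProb r₀ (K ^ (j₀ + 1 + d)) :=
      calc P * (c ^ d * L' ^ (d + 1)) ≤ P * critTwoArmProb (K ^ j₀) (K ^ (j₀ + 1 + d)) :=
            mul_le_mul_of_nonneg_left hb3 hP.le
        _ = c * (critTwoArmProb r₀ (K ^ j₀) * critTwoArmProb (K ^ j₀) (K ^ (j₀ + 1 + d))) := by
            rw [hP_def]; ring
        _ ≤ critTwoArmProb r₀ (K ^ (j₀ + 1 + d)) := hb2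
    have hcdL : 0 < c ^ d * L' ^ (d + 1) := mul_pos (pow_pos hc _) (pow_pos hL'0 _)
    have hVpos : 0 < P * (c ^ d * L' ^ (d + 1)) := mul_pos hP hcdL
    have hlogV : Real.log (P * (c ^ d * L' ^ (d + 1))) =
        Real.log P + d * Real.log c + ((d + 1 : ℕ) : ℝ) * Real.log L' := by
      rw [Real.log_mul hP.ne' hcdL.ne', Real.log_mul (pow_pos hc _).ne' (pow_pos hL'0 _).ne',
        Real.log_pow, Real.log_pow]
      ring
    have hlog_ge : Real.log P + d * Real.log c + ((d + 1 : ℕ) : ℝ) * Real.log L' ≤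
        Real.log (critTwoArmProb r₀ (K ^ (j₀ + 1 + d))) := by
      rw [← hlogV]
      exact Real.log_le_log hVpos hV
    have hn0 : (0 : ℝ) < ((j₀ + 1 + d : ℕ) : ℝ) := by exact_mod_cast (show 0 < j₀ + 1 + d by omega)
    have hnlogK_pos : 0 < ((j₀ + 1 + d : ℕ) : ℝ) * Real.log K := mul_pos hn0 hlogKpos
    have hlogKn : Real.log (((K ^ (j₀ + 1 + d) : ℕ) : ℝ)) = ((j₀ + 1 + d : ℕ) : ℝ) * Real.log K := by
      rw [Nat.cast_pow, Real.log_pow]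
    show ((Real.log c + Real.log L') * d + (Real.log P + Real.log L')) /
        (Real.log K * d + ((j₀ : ℝ) + 1) * Real.log K) ≤
      Real.log (critTwoArmProb r₀ (K ^ (j₀ + 1 + d))) / Real.log (((K ^ (j₀ + 1 + d) : ℕ) : ℝ))
    rw [hlogKn]
    calc ((Real.log c + Real.log L') * d + (Real.log P + Real.log L')) /
          (Real.log K * d + ((j₀ : ℝ) + 1) * Real.log K)
        = (Real.log P + d * Real.log c + ((d + 1 : ℕ) : ℝ) * Real.log L') /
            (((j₀ + 1 + d : ℕ) : ℝ) * Real.log K) := by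
          push_cast; ring
      _ ≤ Real.log (critTwoArmProb r₀ (K ^ (j₀ + 1 + d))) / (((j₀ + 1 + d : ℕ) : ℝ) * Real.log K) :=
          div_le_div_of_nonneg_right hlog_ge hnlogK_pos.le
  have := (div_le_iff₀ hlogKpos).1 hle
  linarith

/-- **The lattice exponent bounds the exponent of the limit from below**: `-1/4 ≤ α`
(`neg_quarter_mul_log_le_log_limit_two` at the ratios `K = 2N`, where `L(2, 2N) = L(1, N)` by
`limit_mul`, and `log L(1, N) / log (2N) → α`). [cite: SmirnovWernerMRL2001, §3 proof of Thm. 3 (p. 5) and §4.2] -/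
theorem neg_quarter_le_exponent
    (hlim : ∀ r R : ℕ, 1 ≤ r → r < R →
      Tendsto (fun ρ : ℕ => critTwoArmProb (ρ * r) (ρ * R)) atTop (𝓝 (L r R)))
    {α : ℝ} (hα : Tendsto (fun n : ℕ => Real.log (L 1 n) / Real.log n) atTop (𝓝 α))
    {r₀ : ℕ} (hr₀ : 1 ≤ r₀) (hE : HasArmExponent ![true, false] r₀ (1 / 4)) : -(1 / 4) ≤ α := by
  have hlogN : Tendsto (fun N : ℕ => Real.log (N : ℝ)) atTop atTop :=
    Real.tendsto_log_atTop.comp tendsto_natCast_atTop_atTop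
  have hlog2pos : 0 < Real.log (2 : ℝ) := Real.log_pos (by norm_num)
  -- `log N / log (2N) → 1`
  have h2 : Tendsto (fun N : ℕ => Real.log (N : ℝ) / Real.log (2 * (N : ℝ))) atTop (𝓝 1) := by
    have h : Tendsto (fun N : ℕ => 1 / (Real.log 2 / Real.log (N : ℝ) + 1)) atTop (𝓝 (1 / (0 + 1))) :=
      tendsto_const_nhds.div ((tendsto_const_nhds.div_atTop hlogN).add tendsto_const_nhds) (by norm_num)
    rw [zero_add, div_one] at h
    refine h.congr' ?_
    filter_upwards [eventually_ge_atTop 2] with N hN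
    have hN : (2 : ℝ) ≤ N := by exact_mod_cast hN
    have hlogNne : Real.log (N : ℝ) ≠ 0 := (Real.log_pos (by linarith)).ne'
    have hsum : Real.log 2 + Real.log (N : ℝ) ≠ 0 := by
      have := Real.log_pos (by linarith : (1 : ℝ) < N); positivity
    rw [Real.log_mul (by norm_num) (by linarith)]
    field_simp
  have h := hα.mul h2
  rw [mul_one] at h
  have h' : Tendsto (fun N : ℕ => Real.log (L 1 N) / Real.log (2 * (N : ℝ))) atTop (𝓝 α) := by
    refine h.congr' ?_
    filter_upwards [eventually_ge_atTop 2] with N hN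
    have hN : (2 : ℝ) ≤ N := by exact_mod_cast hN
    have hlogNne : Real.log (N : ℝ) ≠ 0 := (Real.log_pos (by linarith)).ne'
    have hlog2Nne : Real.log (2 * (N : ℝ)) ≠ 0 := (Real.log_pos (by linarith)).ne'
    field_simp
  refine ge_of_tendsto h' ?_
  filter_upwards [eventually_ge_atTop 2] with N hN
  have hN : (2 : ℝ) ≤ N := by exact_mod_cast hN
  have hlog2N : 0 < Real.log (2 * (N : ℝ)) := Real.log_pos (by linarith)
  have hK := neg_quarter_mul_log_le_log_limit_two hlim hr₀ hE (K := 2 * N) (by omega)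
  have hmul : L 2 (2 * N) = L 1 N := by
    have := limit_mul hlim (r := 1) (R := N) (k := 2) le_rfl (by omega) (by norm_num)
    rwa [Nat.mul_one] at this
  rw [hmul] at hK
  push_cast at hK
  rw [le_div_iff₀ hlog2N]
  exact hK

/-- **The lattice exponent bounds the exponent of the limit from above**: with
quasi-multiplicativity (B), `α ≤ -1/4` (`log_limit_one_le_of_quasiMult` divided by `log K`,
`K → ∞`). [cite: SmirnovWernerMRL2001, §3 proof of Thm. 3 (p. 5) and §4 (10)] -/
theorem exponent_le_neg_quarter
    (hlim : ∀ r R : ℕ, 1 ≤ r → r < R →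
      Tendsto (fun ρ : ℕ => critTwoArmProb (ρ * r) (ρ * R)) atTop (𝓝 (L r R)))
    {α : ℝ} (hα : Tendsto (fun n : ℕ => Real.log (L 1 n) / Real.log n) atTop (𝓝 α))
    {c : ℝ} (hc : 0 < c) {n₀ : ℕ}
    (hqm : ∀ n₁ n₂ n₃ : ℕ, n₀ ≤ n₁ → n₁ < n₂ → n₂ < n₃ →
      c * (critTwoArmProb n₁ n₂ * critTwoArmProb n₂ n₃) ≤ critTwoArmProb n₁ n₃)
    {r₀ : ℕ} (hr₀ : 1 ≤ r₀) (hr₀' : n₀ ≤ r₀) (hE : HasArmExponent ![true, false] r₀ (1 / 4)) :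
    α ≤ -(1 / 4) := by
  have hlogK : Tendsto (fun K : ℕ => Real.log (K : ℝ)) atTop atTop :=
    Real.tendsto_log_atTop.comp tendsto_natCast_atTop_atTop
  have h : Tendsto (fun K : ℕ => Real.log c / Real.log (K : ℝ) + Real.log (L 1 K) / Real.log K) atTop
      (𝓝 (0 + α)) :=
    (tendsto_const_nhds.div_atTop hlogK).add hα
  rw [zero_add] at h
  refine le_of_tendsto h ?_
  filter_upwards [eventually_ge_atTop 3] with K hK
  have hKR : (3 : ℝ) ≤ K := by exact_mod_cast hK
  have hlogKpos : 0 < Real.log (K : ℝ) := Real.log_pos (by linarith)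
  have hb := log_limit_one_le_of_quasiMult hlim hc hqm hr₀ hr₀' hE hK
  rw [← add_div, div_le_iff₀ hlogKpos]
  linarith

end TwoArmScalingLimit

open TwoArmScalingLimit in
/-- **The fact from (16)ℕ, quasi-multiplicativity and the lattice exponent.** If the two-arm
probabilities of the integer annuli converge (SW (16)), quasi-multiplicativity (B) holds and
the lattice two-arm probabilities have exponent `1/4` (`twoArm_exponent`), then
`SmirnovWerner2001_twoArm_scalingLimit` holds: the exponent of the limit exists
(`exists_tendsto_log_limit_div_log`) and is pinned to `-1/4` by the two chains of
`ArmExponentsTwoArm.lean` run backwards (`neg_quarter_le_exponent`, `exponent_le_neg_quarter`).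
[cite: SmirnovWernerMRL2001, §3 proof of Thm. 3 (p. 5), §4 (9), (10), (16)] -/
theorem SmirnovWerner2001_twoArm_scalingLimit_of_limits_of_twoArm_exponent (L : ℕ → ℕ → ℝ)
    (hlim : ∀ r R : ℕ, 1 ≤ r → r < R →
      Tendsto (fun ρ : ℕ => critTwoArmProb (ρ * r) (ρ * R)) atTop (𝓝 (L r R)))
    (hB : Nolin2008_twoArm_quasiMult) (hT : twoArm_exponent) :
    SmirnovWerner2001_twoArm_scalingLimit := by
  obtain ⟨α, hα⟩ := exists_tendsto_log_limit_div_log hlim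
  obtain ⟨c, hc, n₀, hqm⟩ := hB
  obtain ⟨r₁, hr₁⟩ := hT
  have hE := hr₁ (max r₁ (max n₀ 1)) (le_max_left _ _)
  have hr₀1 : 1 ≤ max r₁ (max n₀ 1) := le_trans (le_max_right n₀ 1) (le_max_right r₁ _)
  have hr₀n : n₀ ≤ max r₁ (max n₀ 1) := le_trans (le_max_left n₀ 1) (le_max_right r₁ _)
  have h1 := neg_quarter_le_exponent hlim hα hr₀1 hE
  have h2 := exponent_le_neg_quarter hlim hα hc hqm hr₀1 hr₀n hE
  have hαeq : α = -(1 / 4) := le_antisymm h2 h1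
  rw [hαeq] at hα
  exact SmirnovWerner2001_twoArm_scalingLimit_of_limits_nat L hlim hα

/-- **Given quasi-multiplicativity, `SmirnovWerner2001_twoArm_scalingLimit` ⇔ (16)ℕ ∧
`twoArm_exponent`.** Modulo the existence of the scaling limits of the two-arm probabilities of
the integer annuli, Smirnov–Werner's continuum input (A) of `ArmExponentsTwoArm.lean` is
equivalent to the target statement `twoArm_exponent` itself (forward: `twoArm_exponent_of_facts`;
backward: `SmirnovWerner2001_twoArm_scalingLimit_of_limits_of_twoArm_exponent`).
[cite: SmirnovWernerMRL2001, Thm. 4 (j = 2), §3 proof of Thm. 3 (p. 5), §4 (9), (10), (16)] -/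
theorem SmirnovWerner2001_twoArm_scalingLimit_iff_limits_and_twoArm_exponent
    (hB : Nolin2008_twoArm_quasiMult) :
    SmirnovWerner2001_twoArm_scalingLimit ↔
      (∃ L : ℕ → ℕ → ℝ, ∀ r R : ℕ, 1 ≤ r → r < R →
        Tendsto (fun ρ : ℕ => critTwoArmProb (ρ * r) (ρ * R)) atTop (𝓝 (L r R))) ∧
      twoArm_exponent := by
  constructor
  · intro h
    obtain ⟨L, hlim, -⟩ := SmirnovWerner2001_twoArm_scalingLimit_iff.1 h
    exact ⟨⟨L, hlim⟩, twoArm_exponent_of_facts h hB⟩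
  · rintro ⟨⟨L, hlim⟩, hT⟩
    exact SmirnovWerner2001_twoArm_scalingLimit_of_limits_of_twoArm_exponent L hlim hB hT

end Literature.Probability.Percolation
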